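import Mathlib
import Literature.Computability.Complexity.RossmanMonotoneCliqueProofs
import HarnessLib

/-!
# Route NegLimited — ladder support `LargeNPow` (line `density-ladder`, stub 1; rung F-N1/p3, ROUND-9 §B)

Registered stub `stub_largeNPow` of the skeleton `density-ladder`
(HOME/pnp-ideate-p3/r9/ladder/density-ladder.lean, sha 2d55ebf8) on the support item
`NegLimited.NeglimitedLogOverOmegaNegations` (stmt-PneNP-19555): Rossman's explicit largeness conditions
`LargeN k δ c₀ η n` (`RossmanMonotoneCliqueFinite.lean`) hold for every sufficiently large `n` also with
the polynomially small acceptance threshold `η = n^{-a}`, for every `0 < a < min (slack/2) (1/8)`.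

Proof: the eight fields of `LargeN` that do not mention `η` are taken from the tree's
`eventually_largeN` (at `η = 1`); the two `η`-fields are re-done: `hγ : 2 k^k ≤ n^{-a} n^{slack/2}`
is `2 k^k ≤ n^{slack/2 - a}` (`eventually_const_le_rpow`, exponent `slack/2 - a > 0`), and
`hcase2 : K n^{-1/8} < n^{-a}/2` is `K n^{-(1/8 - a)} < 1/2` times `n^{-a} > 0`
(`eventually_mul_rpow_neg_lt`, exponent `1/8 - a > 0`).
-/

set_option linter.dupNamespace false -- `Summit.PneNP.PneNP.…`: summit = sub-problem name (D-0017 single-conjunct layout)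

namespace Summit.PneNP.PneNP.Theorems.NegLimitedLadder

open Finset Filter
open Literature.Computability.Complexity Literature.Combinatorics.SetFamily

/-- The stub statement `LargeNPow` (verbatim from the registered skeleton `density-ladder`): Rossman's
largeness conditions hold eventually also with `η = n^{-a}`, for any `a` below `slack/2` (field `hγ`)
and `1/8` (field `hcase2`). -/
def LargeNPow : Prop :=
  ∀ k : ℕ, 5 ≤ k → ∀ δ : ℝ, 0 < δ → δ ≤ 1 / (k : ℝ) ^ 3 → ∀ c₀ a : ℝ, 0 < a → a < slack k δ / 2 →
    a < 1 / 8 → ∀ᶠ n : ℕ in atTop, LargeN k δ c₀ ((n : ℝ) ^ (-a)) n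

/-- **Stub 1 of line `density-ladder` PROVED** (`LargeNPow`, by name): `eventually_largeN` supplies the
`η`-free fields; the two `η`-fields are power-versus-constant comparisons at the exponents
`slack/2 - a > 0` and `1/8 - a > 0`. -/
theorem stub_largeNPow : LargeNPow := by
  intro k hk δ hδ0 hδ1 c₀ a ha0 haS ha8
  -- the `η`-independent fields, from the tree's `eventually_largeN` at `η = 1`
  have e0 := eventually_largeN hk hδ0 hδ1 c₀ 1 one_pos
  -- `2 k^k ≤ n^{slack/2 - a}`
  have e8 := eventually_const_le_rpow (c := slack k δ / 2 - a) (by linarith) (2 * (k : ℝ) ^ k)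
  -- `K · n^{-(1/8 - a)} < 1/2`
  have e9 := eventually_mul_rpow_neg_lt (c := 1 / 8 - a) (by linarith) (by norm_num : (0 : ℝ) < 1 / 2)
    (max c₀ 1 * ((k * (k ^ 2 + 1) : ℕ) : ℝ) * ((2 * spreadConst) ^ (k ^ 2) * (k : ℝ) ^ k))
  filter_upwards [e0, e8, e9, eventually_gt_atTop 0] with n h0 h8 h9 hn0
  have hnr : (0 : ℝ) < n := by exact_mod_cast hn0
  have hna : 0 < (n : ℝ) ^ (-a) := Real.rpow_pos_of_pos hnr _
  refine ⟨h0.hkn, h0.hp, h0.ht, h0.hε, h0.hlog9, h0.hlogq, h0.hB, ?_, ?_, h0.hfinal⟩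
  · -- `hγ`
    calc 2 * (k : ℝ) ^ k ≤ (n : ℝ) ^ (slack k δ / 2 - a) := h8
      _ = (n : ℝ) ^ (-a) * (n : ℝ) ^ (slack k δ / 2) := by
          rw [← Real.rpow_add hnr]
          congr 1
          ring
  · -- `hcase2`
    have hsplit : (n : ℝ) ^ (-(1 / 8 : ℝ)) = (n : ℝ) ^ (-(1 / 8 - a)) * (n : ℝ) ^ (-a) := by
      rw [← Real.rpow_add hnr]
      congr 1
      ring
    calc max c₀ 1 * ((k * (k ^ 2 + 1) : ℕ) : ℝ) * ((2 * spreadConst) ^ (k ^ 2) * (k : ℝ) ^ k) *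
          (n : ℝ) ^ (-(1 / 8 : ℝ))
        = (max c₀ 1 * ((k * (k ^ 2 + 1) : ℕ) : ℝ) * ((2 * spreadConst) ^ (k ^ 2) * (k : ℝ) ^ k) *
            (n : ℝ) ^ (-(1 / 8 - a))) * (n : ℝ) ^ (-a) := by
          rw [hsplit]
          ring
      _ < 1 / 2 * (n : ℝ) ^ (-a) := mul_lt_mul_of_pos_right h9 hna
      _ = (n : ℝ) ^ (-a) / 2 := by ring

end Summit.PneNP.PneNP.Theorems.NegLimitedLadder
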